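import Summits.RiemannHypothesis.RiemannHypothesis.Theses.RuelleBand
import Literature.NumberTheory.LFunctions.RHWave0HardyProofs

/-!
# `CofiniteCriticalLine` (crux stmt-RiemannHypothesis-2064) — load-bearing analysis (negative lemmas)

The crux of route RuelleBand, rank 5, is
`CofiniteCriticalLine := {s : ℂ | riemannZeta s = 0 ∧ 0 < s.re ∧ s.re < 1 ∧ s.re ≠ 1 / 2}.Finite`.
This file records, kernel-checked, what happens when one conjunct of the set-builder is dropped
(refuter's standing-adversary output, cdisprove cycle 1; statements inline, no new definitions):

* `cofiniteCriticalLine_false_without_neHalf` — drop `s.re ≠ 1/2`: FALSE, by Hardy's theorem (1914), which is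
  PROVED in tree (`Literature.NumberTheory.LFunctions.hardy_infinite_zeros_on_critical_line_holds`);
* `cofiniteCriticalLine_false_without_rePos` — drop `0 < s.re`: FALSE (the trivial zeros `-2(n+1)`);
* `cofiniteCriticalLine_false_without_zeta` — drop `riemannZeta s = 0`: FALSE (witnesses `1/4 + n i`);
* `cofiniteCriticalLine_iff_without_ltOne` — drop `s.re < 1`: EQUIVALENT to the crux (no zeros on `re s ≥ 1`,
  Mathlib `riemannZeta_ne_zero_of_one_le_re`): the conjunct is decoration for `ζ`.

So any proof must use the off-line condition and the restriction to `re s > 0`; the window `re s < 1` is free.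
-/

noncomputable section

open Complex Set

namespace Summit.RiemannHypothesis.Cruxes.CofiniteCriticalLine.Negative

open Summit.RiemannHypothesis.RiemannHypothesis.Theses.RuelleBand
open Literature.NumberTheory.LFunctions

/-- A trivial zero `-2(n+1)` is the real number `-2(n+1)` cast to `ℂ`. [folklore] -/
theorem trivialZero_eq_ofReal (n : ℕ) : (-2 * ((n : ℂ) + 1)) = ((-2 * ((n : ℝ) + 1) : ℝ) : ℂ) := by
  push_cast; ring

/-- Dropping `s.re ≠ 1/2` makes the crux FALSE: "finitely many zeros in the open strip" contradicts
Hardy's theorem (infinitely many zeros `1/2 + it`; Hardy 1914, Titchmarsh §10.2; proved in tree).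
[cite: Hardy1914, C. R. Acad. Sci. Paris 158] -/
theorem cofiniteCriticalLine_false_without_neHalf :
    ¬ {s : ℂ | riemannZeta s = 0 ∧ 0 < s.re ∧ s.re < 1}.Finite := by
  intro hfin
  have himg : ((fun t : ℝ => (1 / 2 : ℂ) + t * I) '' {t : ℝ | riemannZeta (1 / 2 + t * I) = 0}).Finite := by
    refine hfin.subset ?_
    rintro _ ⟨t, ht, rfl⟩
    refine ⟨ht, ?_, ?_⟩ <;> norm_num
  refine hardy_infinite_zeros_on_critical_line_holds (himg.of_finite_image ?_)
  intro a _ b _ hab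
  have := congrArg Complex.im hab
  simpa using this

/-- Dropping `0 < s.re` makes the crux FALSE: the trivial zeros `-2(n+1)`
(Mathlib `riemannZeta_neg_two_mul_nat_add_one`) are infinitely many, have `re s < 1` and `re s ≠ 1/2`.
[folklore] -/
theorem cofiniteCriticalLine_false_without_rePos :
    ¬ {s : ℂ | riemannZeta s = 0 ∧ s.re < 1 ∧ s.re ≠ 1 / 2}.Finite := by
  intro hfin
  have hinj : Function.Injective (fun n : ℕ => (-2 * ((n : ℂ) + 1))) := by
    intro a b hab
    have h := congrArg Complex.re hab
    simp only [trivialZero_eq_ofReal, ofReal_re] at h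
    exact_mod_cast (by linarith : (a : ℝ) = b)
  refine (Set.infinite_range_of_injective hinj) (hfin.subset ?_)
  rintro _ ⟨n, rfl⟩
  have hn : (0 : ℝ) ≤ n := n.cast_nonneg
  refine ⟨riemannZeta_neg_two_mul_nat_add_one n, ?_, ?_⟩
  · show (-2 * ((n : ℂ) + 1)).re < 1
    rw [trivialZero_eq_ofReal, ofReal_re]; linarith
  · show (-2 * ((n : ℂ) + 1)).re ≠ 1 / 2
    rw [trivialZero_eq_ofReal, ofReal_re]; intro h; linarith

/-- Dropping `riemannZeta s = 0` makes the crux FALSE (sanity check): witnesses `1/4 + n i`. [folklore] -/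
theorem cofiniteCriticalLine_false_without_zeta :
    ¬ {s : ℂ | 0 < s.re ∧ s.re < 1 ∧ s.re ≠ 1 / 2}.Finite := by
  intro hfin
  have hinj : Function.Injective (fun n : ℕ => ((1 / 4 : ℝ) : ℂ) + (n : ℂ) * I) := by
    intro a b hab
    have h := congrArg Complex.im hab
    simp at h
    exact_mod_cast h
  refine (Set.infinite_range_of_injective hinj) (hfin.subset ?_)
  rintro _ ⟨n, rfl⟩
  refine ⟨?_, ?_, ?_⟩ <;> norm_num

/-- The set with `s.re < 1` dropped IS the crux's exceptional set: `ζ` has no zeros on `re s ≥ 1`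
(Hadamard–de la Vallée Poussin; Mathlib `riemannZeta_ne_zero_of_one_le_re`). [folklore] -/
theorem setOf_without_ltOne_eq :
    {s : ℂ | riemannZeta s = 0 ∧ 0 < s.re ∧ s.re ≠ 1 / 2} =
      {s : ℂ | riemannZeta s = 0 ∧ 0 < s.re ∧ s.re < 1 ∧ s.re ≠ 1 / 2} := by
  ext s
  simp only [mem_setOf_eq]
  constructor
  · rintro ⟨hz, h0, hne⟩
    refine ⟨hz, h0, ?_, hne⟩
    by_contra h
    exact riemannZeta_ne_zero_of_one_le_re (not_lt.1 h) hz
  · rintro ⟨hz, h0, -, hne⟩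
    exact ⟨hz, h0, hne⟩

/-- Dropping `s.re < 1` gives an EQUIVALENT statement: the conjunct is decoration for `ζ`
(information for the prover: nothing in a proof can hinge on it). [folklore] -/
theorem cofiniteCriticalLine_iff_without_ltOne :
    CofiniteCriticalLine ↔ {s : ℂ | riemannZeta s = 0 ∧ 0 < s.re ∧ s.re ≠ 1 / 2}.Finite := by
  rw [setOf_without_ltOne_eq]
  rfl

end Summit.RiemannHypothesis.Cruxes.CofiniteCriticalLine.Negative

end
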